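import Summits.Ventures.YMGap.RobustBall.UniformPlaquetteCorrFn
import Summits.Ventures.YMGap.RobustBall.UniformLoopCorrelatorDecay
import HarnessLib

/-!
# Venture YMGap, track ROBUST-BALL (Y2) — the certified uniform rate GROWS LOGARITHMICALLY at strong coupling:
# `m(β_W) ≥ log(1/(8β_W))` at the Wilson point and on the loop ball

HONEST FRAMING. WHAT THIS IS: a venture file (cell `pub-ymgap`, track Y2 ROBUST-BALL, seat rb-p1, theorems only). The tier-2 door
of `SummableMassGap.lean` clusters at the WEIGHT `t` of the norm whenever `6|β_W| e^{a} e^{t} + e^{a/2}√(2/3)Λ < 1`; choosing the weight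
as large as the door allows, `e^{t} = 1/(8β_W)`, gives an explicit rate that grows like `log(1/β_W)` as `β_W → 0` — the qualitative
behaviour of the strong-coupling glueball mass (`∼ −4 log β_W` to leading order; here a LOWER bound with coefficient `1`):
* `su2_wilson_clustering_rate` — `SU(2)`, `d = 4`, `0 < β_W < 1/8`: EVERY DLR state of the Wilson theory clusters at rate `log(1/(8β_W))`
  with constant `16 n²` (`PerturbedClustering 4 2 (β_W/4) 0 ∅ (log(1/(8β_W))) 16`); `su2_wilson_hasExponentialDecayRate_plaquetteCorrFn_rate` —
  Chatterjee's `f_β` has `HasExponentialDecayRate … (log(1/(8β_W)))` for every `μ ∈ ymGibbsMeasures (fundamentalRep (Fin 2)) (β_W/2)`;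
* `su2_uniformLoopBall_rate` — the LOOP BALL of radius `1/10` at that weight: for `0 < β_W < 1/8`,
  `UniformMassGapOnLoopBall 4 2 (β_W/4) (log(1/(8β_W))) (1/10) (log(1/(8β_W))) 16` — every generic Wilson-type loop action with
  `‖c‖_{log(1/(8β_W))} ≤ 0.1` has one DLR state and ALL of them cluster at rate `log(1/(8β_W))` (lineage B, `3√3/8·T(1/5) + T(1/10)·0.08165 < 1`);
* every `N ≥ 2` ('t Hooft `0 < β < 1/64`, Bakry–Émery): `suN_wilson_clustering_rate` — every DLR state of `SU(N)` Wilson on `ℤ⁴` clusters at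
  rate `log(1/(64β))` with constant `8N n²`; `suN_uniformBallZdS_rate` (weighted ball `(1/20, 1/20)` at that weight).
WHAT THIS IS NOT: lower bounds from the Dobrushin comparison (coefficient `1·log(1/β_W)`, not the physical `4·log`); strong-coupling
LATTICE statements; nothing about the continuum limit or a Clay-sense mass gap.
-/

noncomputable section

open MeasureTheory Filter Function ProbabilityTheory Real
open scoped NNReal
open Literature.Probability.LatticeModels
open Literature.Probability.LatticeModels.DobrushinMetric
open Literature.MathematicalPhysics.QuantumLattice
open Literature.MathematicalPhysics.QuantumFieldTheory hiding ZdEdge Site plaquetteObs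

namespace Summit.Ventures.YMGap.RobustBall

/-! ### `SU(2)`: the Wilson point at rate `log(1/(8β_W))` -/

/-- `e^{log(1/(8β_W))} = 1/(8β_W)` and the weight is positive for `0 < β_W < 1/8`. -/
theorem exp_log_inv_eight_mul {βW : ℝ} (h0 : 0 < βW) : Real.exp (Real.log (1 / (8 * βW))) = 1 / (8 * βW) :=
  Real.exp_log (by positivity)

/-- **THE TIER-2 `SU(2)` BALL AT THE MAXIMAL WEIGHT**: for `0 < β_W < 1/8` and loads `(a, Λ)` with
`(3/4) e^{a} + e^{a/2}√(2/3) Λ < 1`: `UniformMassGapOnBallZdS 4 2 (β_W/4) a Λ (log(1/(8β_W))) (log(1/(8β_W))) 16`. [folklore] -/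
theorem su2_uniformBallZdS_rate {βW a Λ : ℝ} (h0 : 0 < βW) (h : βW < 1 / 8)
    (hρ : 3 / 4 * Real.exp a + Real.exp (a / 2) * Real.sqrt (2 / 3) * Λ < 1) :
    UniformMassGapOnBallZdS 4 2 (βW / 4) a Λ (Real.log (1 / (8 * βW))) (Real.log (1 / (8 * βW))) 16 := by
  have ht : 0 < Real.log (1 / (8 * βW)) := Real.log_pos (by rw [lt_div_iff₀ (by positivity)]; linarith)
  refine su2_uniformMassGapOnBallZdS_dim4 ht ?_
  rw [exp_log_inv_eight_mul h0, abs_of_pos h0]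
  have e : 6 * βW * (Real.exp a * (1 / (8 * βW))) = 3 / 4 * Real.exp a := by field_simp; ring
  rw [e]; exact hρ

/-- **EVERY DLR STATE OF `SU(2)` WILSON ON `ℤ⁴` CLUSTERS AT RATE `log(1/(8β_W))`**, constant `16 n²`, for `0 < β_W < 1/8` — the certified
rate grows logarithmically at strong coupling. [folklore] -/
theorem su2_wilson_clustering_rate {βW : ℝ} (h0 : 0 < βW) (h : βW < 1 / 8) :
    PerturbedClustering 4 2 (βW / 4) 0 (fun _ => (∅ : Finset (Finset (ZdEdge 4)))) (Real.log (1 / (8 * βW))) 16 := by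
  have hS := su2_uniformBallZdS_rate (a := 0) (Λ := 0) h0 h (by rw [Real.exp_zero, zero_div, Real.exp_zero]; norm_num)
  have hZd : UniformMassGapOnBallZd 4 2 (βW / 4) 0 0 0 (Real.log (1 / (8 * βW))) 16 :=
    hS.uniformMassGapOnBallZd (Real.log_pos (by rw [lt_div_iff₀ (by positivity)]; linarith)).le le_rfl (by simp)
  exact hZd.clustering_wilson le_rfl le_rfl

/-- **Chatterjee's `f_β` with the logarithmic rate**: for `0 < β_W < 1/8`, every `μ ∈ ymGibbsMeasures (fundamentalRep (Fin 2)) (β_W/2)` has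
`HasExponentialDecayRate (plaquetteCorrFn … μ) (log(1/(8β_W)))`. [folklore] -/
theorem su2_wilson_hasExponentialDecayRate_plaquetteCorrFn_rate {βW : ℝ} (h0 : 0 < βW) (h : βW < 1 / 8)
    {μ : Measure (LGConfig 4 (SUN 2))} (hμ : μ ∈ ymGibbsMeasures (d := 4) (fundamentalRep (Fin 2)) (βW / 2)) :
    HasExponentialDecayRate (plaquetteCorrFn (fundamentalRep (Fin 2)) μ) (Real.log (1 / (8 * βW))) := by
  have hμ' : μ ∈ perturbedGibbsMeasures (d := 4) (fundamentalRep (Fin 2)) (2 * (βW / 4)) 0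
      (fun _ => (∅ : Finset (Finset (ZdEdge 4)))) := by
    rw [perturbedGibbsMeasures_zero]
    have e : (2 : ℝ) * (βW / 4) = βW / 2 := by ring
    rwa [e]
  exact (su2_wilson_clustering_rate h0 h).hasExponentialDecayRate_plaquetteCorrFn (N := 2) (by norm_num)
    (Real.log_pos (by rw [lt_div_iff₀ (by positivity)]; linarith)) hμ'

/-- **Wilson loops at the Wilson point, logarithmic rate**: for `0 < β_W < 1/8`, every DLR state, two closed walks with disjoint link sets and
lengths `≤ n`: `|Cov_μ(W_γ₁, W_γ₂)| ≤ 16 n²(2n²+1)·e^{−log(1/(8β_W))·d(γ₁,γ₂)} = 16 n²(2n²+1)·(8β_W)^{d(γ₁,γ₂)}`. [folklore] -/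
theorem su2_wilson_loop_decay_rate {βW : ℝ} (h0 : 0 < βW) (h : βW < 1 / 8)
    {μ : Measure (LGConfig 4 (SUN 2))} (hμ : μ ∈ ymGibbsMeasures (d := 4) (fundamentalRep (Fin 2)) (βW / 2))
    {x₁ x₂ : Literature.Probability.LatticeModels.Site 4} (w₁ : (zdGraph 4).Walk x₁ x₁) (w₂ : (zdGraph 4).Walk x₂ x₂) {n : ℕ}
    (h₁ : w₁.length ≤ n) (h₂ : w₂.length ≤ n)
    (hdisj : Disjoint (Literature.MathematicalPhysics.QuantumFieldTheory.walkEdges w₁)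
      (Literature.MathematicalPhysics.QuantumFieldTheory.walkEdges w₂)) :
    |cov[loopTerm (d := 4) 2 1 w₁, loopTerm (d := 4) 2 1 w₂; μ]| ≤
      16 * (n : ℝ) ^ 2 * (2 * (n : ℝ) ^ 2 + 1) * Real.exp (-Real.log (1 / (8 * βW)) *
        setDistEdges (Literature.MathematicalPhysics.QuantumFieldTheory.walkEdges w₁)
          (Literature.MathematicalPhysics.QuantumFieldTheory.walkEdges w₂)) := by
  have hμ' : μ ∈ perturbedGibbsMeasures (d := 4) (fundamentalRep (Fin 2)) (2 * (βW / 4)) 0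
      (fun _ => (∅ : Finset (Finset (ZdEdge 4)))) := by
    rw [perturbedGibbsMeasures_zero]
    have e : (2 : ℝ) * (βW / 4) = βW / 2 := by ring
    rwa [e]
  have h' := (su2_wilson_clustering_rate h0 h).abs_cov_loop_le (by norm_num) hμ' w₁ w₂ h₁ h₂ hdisj
  simpa only [Nat.cast_ofNat] using h'

/-! ### `SU(2)`: the loop ball of radius `1/10` at the maximal weight -/

/-- **THE LOOP BALL AT RATE `log(1/(8β_W))`**: for `0 < β_W < 1/8`, every generic Wilson-type loop action on `ℤ⁴` with finite carrier fibres
and `‖c‖_{log(1/(8β_W))} ≤ 1/10` has one DLR state and ALL of them cluster at rate `log(1/(8β_W))` with constant `16 n²`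
(lineage B: `3√3·β_W·(1/(8β_W))·T(1/5) + T(1/10)·0.8165/10 ≤ 0.8836 < 1`). [folklore] -/
theorem su2_uniformLoopBall_rate {βW : ℝ} (h0 : 0 < βW) (h : βW < 1 / 8) :
    UniformMassGapOnLoopBall 4 2 (βW / 4) (Real.log (1 / (8 * βW))) (1 / 10) (Real.log (1 / (8 * βW))) 16 := by
  have hq : 1 < 1 / (8 * βW) := by rw [lt_div_iff₀ (by positivity)]; linarith
  have hrow : UniformMassGapOnBallZdS 4 2 (βW / 4) (2 * (1 / 10)) (1 / 10) (Real.log (1 / (8 * βW)))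
      (Real.log (1 / (8 * βW))) 16 := by
    refine su2_uniformRowBS hq h0.le (by linarith) (by norm_num) (by norm_num) ?_
    have e : 3 * (1732051 / 1000000 : ℝ) * βW * (1 / (8 * βW)) = 3 * (1732051 / 1000000) / 8 := by
      field_simp
    rw [e]
    norm_num
  exact hrow.uniformMassGapOnLoopBall

/-! ### Every `N ≥ 2`: the Wilson point at rate `log(1/(64β))` -/

/-- **EVERY `N ≥ 2`, `d = 4`, 't Hooft `0 < β < 1/64`, HYPOTHESIS-FREE (Bakry–Émery)**: the weighted ball of loads `(a, Λ) = (1/20, 1/20)` at weight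
`log(1/(64β))` is uniform with that rate and constant `8N` (`b = 6β ≤ 3/32`, `1/2 − b ≥ 3/8`; row sum
`(18/64) e^{1/20}/(3/8) + e^{1/40}(1/20)/√(3N/8) ≤ 0.849`). [folklore] -/
theorem suN_uniformBallZdS_rate {N : ℕ} (hN : 2 ≤ N) {β : ℝ} (h0 : 0 < β) (h : β < 1 / 64) :
    UniformMassGapOnBallZdS 4 N β (1 / 20) (1 / 20) (Real.log (1 / (64 * β))) (Real.log (1 / (64 * β))) (8 * N) := by
  have hq0 : 0 < 1 / (64 * β) := by positivity
  have hq : 1 < 1 / (64 * β) := by rw [lt_div_iff₀ (by positivity)]; linarith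
  have ht : 0 < Real.log (1 / (64 * β)) := Real.log_pos hq
  have hN2 : (2 : ℝ) ≤ N := by exact_mod_cast hN
  have hb : |β| * (2 * (((4 : ℕ) : ℝ) - 1)) < 1 / 2 := by rw [abs_of_pos h0]; norm_num; linarith
  refine suN_uniformMassGapOnBallZdS_bakryEmery (d := 4) (by norm_num) hN ht hb ?_
  rw [Real.exp_log hq0, abs_of_pos h0]
  have h1 := exp_le_taylor4 (x := 1 / 20) (by norm_num) (by norm_num)
  have h2 := exp_le_taylor4 (x := 1 / 20 / 2) (by norm_num) (by norm_num)
  have hgap : 3 / 8 ≤ 1 / 2 - β * (2 * (((4 : ℕ) : ℝ) - 1)) := by norm_num; linarith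
  have hgap0 : 0 < 1 / 2 - β * (2 * (((4 : ℕ) : ℝ) - 1)) := by linarith
  have hs : (43 / 50 : ℝ) ≤ Real.sqrt ((N : ℝ) * (1 / 2 - β * (2 * (((4 : ℕ) : ℝ) - 1)))) := by
    rw [show (43 / 50 : ℝ) = Real.sqrt ((43 / 50) ^ 2) by rw [Real.sqrt_sq (by norm_num)]]
    exact Real.sqrt_le_sqrt (by nlinarith)
  have hs0 : (0 : ℝ) < Real.sqrt ((N : ℝ) * (1 / 2 - β * (2 * (((4 : ℕ) : ℝ) - 1)))) := by linarith
  have hfirst : 6 * (((4 : ℕ) : ℝ) - 1) * β * (Real.exp (1 / 20) * (1 / (64 * β))) / (1 / 2 - β * (2 * (((4 : ℕ) : ℝ) - 1))) ≤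
      18 / 64 * (1 + 1 / 20 + (1 / 20 : ℝ) ^ 2 / 2 + (1 / 20) ^ 3 / 6 + 5 / 96 * (1 / 20) ^ 4) / (3 / 8) := by
    have e : 6 * (((4 : ℕ) : ℝ) - 1) * β * (Real.exp (1 / 20) * (1 / (64 * β))) = 18 / 64 * Real.exp (1 / 20) := by
      field_simp; ring
    rw [e]
    exact div_le_div₀ (by positivity) (by nlinarith [Real.exp_pos (1/20 : ℝ)]) (by norm_num) hgap
  have hsecond : Real.exp (1 / 20 / 2) * (1 / 20) / Real.sqrt ((N : ℝ) * (1 / 2 - β * (2 * (((4 : ℕ) : ℝ) - 1)))) ≤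
      (1 + 1 / 20 / 2 + (1 / 20 / 2 : ℝ) ^ 2 / 2 + (1 / 20 / 2) ^ 3 / 6 + 5 / 96 * (1 / 20 / 2) ^ 4) * (1 / 20) / (43 / 50) := by
    rw [div_le_div_iff₀ hs0 (by norm_num)]
    have he0 : 0 < Real.exp (1 / 20 / 2) := Real.exp_pos _
    nlinarith [hs, h2, he0]
  calc 6 * (((4 : ℕ) : ℝ) - 1) * β * (Real.exp (1 / 20) * (1 / (64 * β))) / (1 / 2 - β * (2 * (((4 : ℕ) : ℝ) - 1))) +
        Real.exp (1 / 20 / 2) * (1 / 20) / Real.sqrt ((N : ℝ) * (1 / 2 - β * (2 * (((4 : ℕ) : ℝ) - 1))))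
      ≤ 18 / 64 * (1 + 1 / 20 + (1 / 20 : ℝ) ^ 2 / 2 + (1 / 20) ^ 3 / 6 + 5 / 96 * (1 / 20) ^ 4) / (3 / 8) +
        (1 + 1 / 20 / 2 + (1 / 20 / 2 : ℝ) ^ 2 / 2 + (1 / 20 / 2) ^ 3 / 6 + 5 / 96 * (1 / 20 / 2) ^ 4) * (1 / 20) / (43 / 50) :=
        add_le_add hfirst hsecond
    _ < 1 := by norm_num

/-- **EVERY `N ≥ 2`: EVERY DLR STATE OF `SU(N)` WILSON ON `ℤ⁴` AT 't Hooft `0 < β < 1/64` CLUSTERS AT RATE `log(1/(64β))`** with constant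
`8N n²` (the zero member of the weighted ball). [folklore] -/
theorem suN_wilson_clustering_rate {N : ℕ} (hN : 2 ≤ N) {β : ℝ} (h0 : 0 < β) (h : β < 1 / 64) :
    PerturbedClustering 4 N β 0 (fun _ => (∅ : Finset (Finset (ZdEdge 4)))) (Real.log (1 / (64 * β))) (8 * N) := by
  have hS := suN_uniformBallZdS_rate hN h0 h
  have ht : 0 ≤ Real.log (1 / (64 * β)) := (Real.log_pos (by rw [lt_div_iff₀ (by positivity)]; linarith)).le
  have hZd : UniformMassGapOnBallZd 4 N β 0 0 0 (Real.log (1 / (64 * β))) (8 * N) :=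
    hS.uniformMassGapOnBallZd ht (by norm_num) (by simp)
  exact hZd.clustering_wilson le_rfl le_rfl

/-- **Every `N ≥ 2`: Chatterjee's `f_β` with the logarithmic rate** — for 't Hooft `0 < β < 1/64` every
`μ ∈ ymGibbsMeasures (fundamentalRep (Fin N)) (N β)` has `HasExponentialDecayRate (plaquetteCorrFn … μ) (log(1/(64β)))`. [folklore] -/
theorem suN_wilson_hasExponentialDecayRate_plaquetteCorrFn_rate {N : ℕ} (hN : 2 ≤ N) {β : ℝ} (h0 : 0 < β) (h : β < 1 / 64)
    {μ : Measure (LGConfig 4 (SUN N))} (hμ : μ ∈ ymGibbsMeasures (d := 4) (fundamentalRep (Fin N)) (N * β)) :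
    HasExponentialDecayRate (plaquetteCorrFn (fundamentalRep (Fin N)) μ) (Real.log (1 / (64 * β))) := by
  have hμ' : μ ∈ perturbedGibbsMeasures (d := 4) (fundamentalRep (Fin N)) (N * β) 0
      (fun _ => (∅ : Finset (Finset (ZdEdge 4)))) := by
    rwa [perturbedGibbsMeasures_zero]
  exact (suN_wilson_clustering_rate hN h0 h).hasExponentialDecayRate_plaquetteCorrFn (by omega)
    (Real.log_pos (by rw [lt_div_iff₀ (by positivity)]; linarith)) hμ'

end Summit.Ventures.YMGap.RobustBall

end
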